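import Literature.NumberTheory.EllipticCurves.KodairaNeronUnramifiedInertiaProofs
import Literature.NumberTheory.EllipticCurves.SelmerFiniteProofs
import HarnessLib

/-!
# The spectral valuation on `K_v^nr`: discrete value group and descent of residues to `K_v`

Topic `NumberTheory/EllipticCurves` (local toolkit at a finite place `v` of a number field `K`,
in the language of `SelmerInertia` / `SelmerFiniteProofs`: `K_v` the completion, `K̄_v` an
algebraic closure with its spectral valuation `|·|_v` (`w`, `hw`), `𝓞_v` with a uniformiser `ϖ`,
the prime `𝔐` of the local absolute integers and its inertia group `I_𝔐 ≤ Γ_{K_v}`, whose fixed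
field is the maximal unramified extension `K_v^nr`, `mem_maxUnramified_iff_forall_inertia`).
Theorems only:

* `exists_spectralValuation_algebraMap_eq_pow`, `spectralValuation_uniformizer_pos_lt_one`:
  `|K_vˣ|_v = |ϖ|_v^ℤ` with `0 < |ϖ|_v < 1` (`𝓞_v` is a discrete valuation ring);
* `exists_spectralValuation_eq_pow_of_forall_inertia`, `spectralValuation_le_of_forall_inertia`:
  **the value group of `K_v^nr` is that of `K_v`** (Neukirch, *ANT*, II (7.5); from the tree's
  `exists_spectralValuation_eq_of_mem_maxUnramified`): an element fixed by `I_𝔐` with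
  `0 < |x|_v < 1` has `|x|_v = |ϖ|_v^m`, `m ≥ 1`, in particular `|x|_v ≤ |ϖ|_v`;
* `exists_spectralValuation_sub_algebraMap_lt_one` (**residues of `Γ_{K_v}`-invariant classes
  descend**): if `|x|_v ≤ 1` and `|σx - x|_v < 1` for *every* `σ ∈ Γ_{K_v}`, then
  `|x - a|_v < 1` for some `a ∈ 𝓞_v`. Proof: by the tree's Teichmüller representatives
  (`IsNonarchimedeanLocalField.exists_rootOfUnity_sub_mem_absMaximalIdeal`, Serre, *Local Fields*,
  II §4 Prop. 8 / IV §4 Prop. 16) `x ≡ ζ` for a root of unity `ζ` of order prime to `p`; then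
  `σζ ≡ ζ` for all `σ`, so `σζ = ζ` (`eq_one_of_pow_eq_one_of_algNorm_sub_one_lt_one`: roots of
  unity of order prime to `p` inject into the residue field), i.e. `ζ ∈ K_v` (`K̄_v/K_v` is
  Galois, `InfiniteGalois.mem_range_algebraMap_iff_fixed`);
* `exists_spectralValuation_sub_algebraMap_le_pow` (**the same to every precision**): if `x` is
  fixed by `I_𝔐` (i.e. `x ∈ 𝒪_{K_v^nr}`) and `|σx - x|_v ≤ |ϖ|_v^m` for every `σ ∈ Γ_{K_v}`, then
  `|x - a|_v ≤ |ϖ|_v^m` for some `a ∈ 𝓞_v` — induction on `m`, dividing by `ϖ` thanks to the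
  discreteness of `|K_v^nr|_v`. This is the statement "`(𝒪_{K^nr}/ϖ^m)^{Gal} = 𝓞_v/ϖ^m`"
  (unramified descent; Serre, *Local Fields*, Ch. II §4, Ch. IV §4) used to descend good
  reduction from `K_v^nr` to `K_v` (Silverman, *AEC*, Prop. VII.5.4(a)) in
  `GoodReductionUnramifiedDescent`.

## References

* [NeukirchANT1999] J. Neukirch, *Algebraic Number Theory*, Springer 1999, Ch. II (4.8), (7.5),
  (9.11).
* [SerreLocalFields1979] J.-P. Serre, *Local Fields*, GTM 67, Springer 1979, Ch. II §4 Prop. 8,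
  Ch. IV §4 Prop. 16 and Cor. 2.
* [SilvermanAEC2009] J. H. Silverman, *The Arithmetic of Elliptic Curves*, 2nd ed., 2009,
  Prop. VII.5.4(a) (the consumer).
-/

noncomputable section

open scoped Classical NNReal

universe u

open NumberField IsDedekindDomain ValuativeRel Field

namespace IsDedekindDomain.HeightOneSpectrum

open Literature.NumberTheory.EllipticCurves Literature.NumberTheory.GaloisRepresentations
  Literature.NumberTheory.GaloisRepresentations.IsNonarchimedeanLocalField

variable {K : Type u} [Field K] [NumberField K] {v : HeightOneSpectrum (𝓞 K)}
  {w : Valuation (AlgebraicClosure (v.adicCompletion K)) ℝ≥0}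
  (hw : ∀ x, (w x : ℝ) = spectralNorm (v.adicCompletion K) (AlgebraicClosure (v.adicCompletion K)) x)
include hw

/-! ## The value group of `K_v` -/

/-- **Discreteness of `|K_vˣ|_v`.** For a uniformiser `ϖ` of `𝓞_v` and `a ∈ K_v` with
`0 < |a|_v < 1`: `|a|_v = |ϖ|_v^m` for some `m ≥ 1` (`a = ϖᵐ·unit` in the discrete valuation
ring `𝓞_v`). Neukirch, *ANT*, Ch. II (3.8)–(4.8). [folklore] -/
theorem exists_spectralValuation_algebraMap_eq_pow {ϖ : v.adicCompletionIntegers K}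
    (hϖ : Irreducible ϖ) {a : v.adicCompletion K}
    (ha0 : 0 < w (algebraMap (v.adicCompletion K) (AlgebraicClosure (v.adicCompletion K)) a))
    (ha1 : w (algebraMap (v.adicCompletion K) (AlgebraicClosure (v.adicCompletion K)) a) < 1) :
    ∃ m : ℕ, 1 ≤ m ∧
      w (algebraMap (v.adicCompletion K) (AlgebraicClosure (v.adicCompletion K)) a) =
        w (algebraMap (v.adicCompletion K) (AlgebraicClosure (v.adicCompletion K))
          (ϖ : v.adicCompletion K)) ^ m := by
  set f := algebraMap (v.adicCompletion K) (AlgebraicClosure (v.adicCompletion K)) with hf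
  have ha : a ∈ v.adicCompletionIntegers K :=
    (spectralValuation_algebraMap_le_one_iff hw a).mp ha1.le
  set a' : v.adicCompletionIntegers K := ⟨a, ha⟩ with ha'
  have ha'0 : a' ≠ 0 := by
    intro h
    have : a = 0 := congrArg Subtype.val h
    rw [this, map_zero, map_zero] at ha0
    exact lt_irrefl _ ha0
  obtain ⟨m, u, hu⟩ := IsDiscreteValuationRing.associated_pow_irreducible ha'0 hϖ
  have hwu : w (f ((u : v.adicCompletionIntegers K) : v.adicCompletion K)) = 1 :=
    spectralValuation_eq_one_of_isUnit hw (Units.isUnit u)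
  have key : w (f a) = w (f (ϖ : v.adicCompletion K)) ^ m := by
    have h := congrArg (fun x : v.adicCompletionIntegers K => w (f (x : v.adicCompletion K))) hu
    rw [Subring.coe_mul, map_mul, map_mul, hwu, mul_one, SubmonoidClass.coe_pow, map_pow,
      map_pow] at h
    exact h
  refine ⟨m, ?_, key⟩
  rcases Nat.eq_zero_or_pos m with rfl | hm
  · rw [pow_zero] at key
    exact absurd key ha1.ne
  · exact hm

/-- `0 < |ϖ|_v < 1` for a uniformiser `ϖ` of `𝓞_v`. [folklore] -/
theorem spectralValuation_uniformizer_pos_lt_one {ϖ : v.adicCompletionIntegers K}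
    (hϖ : Irreducible ϖ) :
    0 < w (algebraMap (v.adicCompletion K) (AlgebraicClosure (v.adicCompletion K))
        (ϖ : v.adicCompletion K)) ∧
      w (algebraMap (v.adicCompletion K) (AlgebraicClosure (v.adicCompletion K))
        (ϖ : v.adicCompletion K)) < 1 := by
  constructor
  · rw [Valuation.pos_iff, map_ne_zero_iff _ (FaithfulSMul.algebraMap_injective _ _)]
    exact_mod_cast hϖ.ne_zero
  · have hint : (Valued.v : Valuation (v.adicCompletion K) _).Integers
        (v.adicCompletionIntegers K) := Valuation.valuationSubring.integers _
    have hle : Valued.v (ϖ : v.adicCompletion K) ≤ 1 := hint.map_le_one ϖ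
    have hne : Valued.v (ϖ : v.adicCompletion K) ≠ 1 := fun h =>
      hϖ.not_isUnit (hint.isUnit_iff_valuation_eq_one.mpr h)
    have hlt : ‖(ϖ : v.adicCompletion K)‖ < 1 :=
      Valued.toNormedField.norm_lt_one_iff.mpr (lt_of_le_of_ne hle hne)
    rw [← NNReal.coe_lt_coe, coe_spectralValuation_algebraMap hw, NNReal.coe_one]
    exact hlt

/-! ## The value group of `K_v^nr` -/

/-- **Levels of elements of `K_v^nr` are integral.** An element `x` of `K̄_v` fixed by the inertia
group `I_𝔐` (i.e. `x ∈ K_v^nr`, `mem_maxUnramified_iff_forall_inertia`) with `0 < |x|_v < 1` has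
`|x|_v = |ϖ|_v^m` for some `m ≥ 1`: the value group of `K_v^nr` is that of `K_v` (Neukirch,
*ANT*, II (7.5); tree `exists_spectralValuation_eq_of_mem_maxUnramified`), which is `|ϖ|_v^ℤ`.
[cite: NeukirchANT1999, Ch. II Prop. (7.5) with Prop. (9.11)] -/
theorem exists_spectralValuation_eq_pow_of_forall_inertia {𝔐 : Ideal v.localAbsIntegers}
    (h𝔐 : 𝔐 ∈ v.localPrimesAbove) {ϖ : v.adicCompletionIntegers K} (hϖ : Irreducible ϖ)
    {x : AlgebraicClosure (v.adicCompletion K)}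
    (hx : ∀ σ ∈ 𝔐.inertia (absoluteGaloisGroup (v.adicCompletion K)),
      absoluteGaloisGroup.toAlgEquiv (v.adicCompletion K) σ x = x)
    (hx0 : 0 < w x) (hx1 : w x < 1) :
    ∃ m : ℕ, 1 ≤ m ∧ w x =
      w (algebraMap (v.adicCompletion K) (AlgebraicClosure (v.adicCompletion K))
        (ϖ : v.adicCompletion K)) ^ m := by
  have hmem : x ∈ maxUnramified (v.adicCompletion K) :=
    (mem_maxUnramified_iff_forall_inertia hw h𝔐).mpr hx
  have hx0' : x ≠ 0 := (Valuation.pos_iff _).mp hx0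
  obtain ⟨a, ha⟩ := exists_spectralValuation_eq_of_mem_maxUnramified hw hmem hx0'
  rw [ha] at hx0 hx1 ⊢
  exact exists_spectralValuation_algebraMap_eq_pow hw hϖ hx0 hx1

/-- An element of `K_v^nr` (fixed by `I_𝔐`) with `|x|_v < 1` has `|x|_v ≤ |ϖ|_v`.
[cite: NeukirchANT1999, Ch. II Prop. (7.5) with Prop. (9.11)] -/
theorem spectralValuation_le_of_forall_inertia {𝔐 : Ideal v.localAbsIntegers}
    (h𝔐 : 𝔐 ∈ v.localPrimesAbove) {ϖ : v.adicCompletionIntegers K} (hϖ : Irreducible ϖ)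
    {x : AlgebraicClosure (v.adicCompletion K)}
    (hx : ∀ σ ∈ 𝔐.inertia (absoluteGaloisGroup (v.adicCompletion K)),
      absoluteGaloisGroup.toAlgEquiv (v.adicCompletion K) σ x = x)
    (hx1 : w x < 1) :
    w x ≤ w (algebraMap (v.adicCompletion K) (AlgebraicClosure (v.adicCompletion K))
      (ϖ : v.adicCompletion K)) := by
  rcases eq_or_lt_of_le (zero_le : 0 ≤ w x) with h0 | h0
  · rw [← h0]; exact zero_le
  · obtain ⟨m, hm, hxm⟩ := exists_spectralValuation_eq_pow_of_forall_inertia hw h𝔐 hϖ hx h0 hx1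
    rw [hxm]
    exact pow_le_of_le_one zero_le (spectralValuation_uniformizer_pos_lt_one hw hϖ).2.le
      (by omega)

/-! ## Residues of `Γ_{K_v}`-invariant classes descend to `K_v` -/

/-- **A class modulo `𝔐` invariant under `Γ_{K_v}` contains an element of `𝓞_v`.** If
`|x|_v ≤ 1` and `|σ x - x|_v < 1` for every `σ ∈ Γ_{K_v} = Gal(K̄_v/K_v)`, then `|x - a|_v < 1`
for some `a ∈ 𝓞_v`: by Teichmüller representatives (Serre, *Local Fields*, Ch. II §4 Prop. 8,
Ch. IV §4 Prop. 16; tree `IsNonarchimedeanLocalField.exists_rootOfUnity_sub_mem_absMaximalIdeal`)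
`x ≡ ζ (mod 𝔐)` with `ζ` a root of unity of order prime to `p` (or `x ≡ 0`); then
`σ ζ ≡ ζ`, hence `σ ζ = ζ` for every `σ` (roots of unity of order prime to `p` inject into the
residue field, `eq_one_of_pow_eq_one_of_algNorm_sub_one_lt_one`), so `ζ ∈ K_v` since `K̄_v/K_v`
is Galois. [cite: SerreLocalFields1979, Ch. IV §4 Prop. 16] -/
theorem exists_spectralValuation_sub_algebraMap_lt_one
    {x : AlgebraicClosure (v.adicCompletion K)} (hx1 : w x ≤ 1)
    (hσ : ∀ σ : absoluteGaloisGroup (v.adicCompletion K),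
      w (absoluteGaloisGroup.toAlgEquiv (v.adicCompletion K) σ x - x) < 1) :
    ∃ a : v.adicCompletionIntegers K,
      w (x - algebraMap (v.adicCompletion K) (AlgebraicClosure (v.adicCompletion K))
        (a : v.adicCompletion K)) < 1 := by
  by_cases hlt : w x < 1
  · exact ⟨0, by simpa using hlt⟩
  have hx : w x = 1 := le_antisymm hx1 (not_lt.mp hlt)
  -- Teichmüller representative `ζ` of `x`
  have hxint : x ∈ absIntegers 𝒪[v.adicCompletion K] (v.adicCompletion K) := by
    rw [mem_absIntegers_iff_algNorm_le_one, ← spectralValuation_le_one_iff_algNorm_le_one hw]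
    exact hx1
  have hb𝔓 : (⟨x, hxint⟩ : absIntegers 𝒪[v.adicCompletion K] (v.adicCompletion K)) ∉
      absMaximalIdeal (v.adicCompletion K) := by
    rw [mem_absMaximalIdeal_iff_algNorm_lt_one, ← spectralValuation_lt_one_iff_algNorm_lt_one hw]
    exact hlt
  obtain ⟨N, ζ, hNu, hζN, hbζ⟩ := exists_rootOfUnity_sub_mem_absMaximalIdeal hb𝔓
  have hxζ : w (x - (ζ : AlgebraicClosure (v.adicCompletion K))) < 1 := by
    rw [spectralValuation_lt_one_iff_algNorm_lt_one hw]
    have h := mem_absMaximalIdeal_iff_algNorm_lt_one.mp hbζ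
    rwa [Subalgebra.coe_sub] at h
  have hζN' : (ζ : AlgebraicClosure (v.adicCompletion K)) ^ N = 1 := by
    have := congrArg Subtype.val hζN
    simpa using this
  have hN0 : N ≠ 0 := by
    rintro rfl
    rw [Nat.cast_zero] at hNu
    exact not_isUnit_zero hNu
  have hζ1 : w (ζ : AlgebraicClosure (v.adicCompletion K)) = 1 := by
    have h := congrArg w hζN'
    rw [map_pow, map_one] at h
    exact (pow_eq_one_iff_of_nonneg zero_le hN0).mp h
  have hζ0 : (ζ : AlgebraicClosure (v.adicCompletion K)) ≠ 0 :=
    (Valuation.ne_zero_iff w).mp (by rw [hζ1]; exact one_ne_zero)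
  -- every `σ ∈ Γ_{K_v}` fixes `ζ`
  have hfix : ∀ σ : AlgebraicClosure (v.adicCompletion K) ≃ₐ[v.adicCompletion K]
      AlgebraicClosure (v.adicCompletion K), σ (ζ : AlgebraicClosure (v.adicCompletion K)) = ζ := by
    intro σ
    have h1 : w (σ (ζ : AlgebraicClosure (v.adicCompletion K)) - ζ) < 1 := by
      have e : σ (ζ : AlgebraicClosure (v.adicCompletion K)) - ζ =
          σ ((ζ : AlgebraicClosure (v.adicCompletion K)) - x) + (σ x - x) + (x - ζ) := by
        rw [map_sub]; ring
      rw [e]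
      refine Valuation.map_add_lt _ (Valuation.map_add_lt _ ?_ (hσ σ)) hxζ
      rw [show σ ((ζ : AlgebraicClosure (v.adicCompletion K)) - x) =
          (absoluteGaloisGroup.toAlgEquiv (v.adicCompletion K)).symm σ •
            ((ζ : AlgebraicClosure (v.adicCompletion K)) - x) from rfl,
        spectralValuation_smul hw, ← Valuation.map_neg, neg_sub]
      exact hxζ
    -- `η = σ ζ / ζ` is an `N`-th root of unity `≡ 1`, hence `= 1`
    have hη : σ (ζ : AlgebraicClosure (v.adicCompletion K)) / ζ = 1 := by
      apply eq_one_of_pow_eq_one_of_algNorm_sub_one_lt_one hNu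
      · rw [div_pow, ← map_pow, hζN', map_one, div_one]
      · rw [← spectralValuation_lt_one_iff_algNorm_lt_one hw,
          show σ (ζ : AlgebraicClosure (v.adicCompletion K)) / ζ - 1 =
            (σ (ζ : AlgebraicClosure (v.adicCompletion K)) - ζ) / ζ by field_simp,
          map_div₀, hζ1, div_one]
        exact h1
    rwa [div_eq_one_iff_eq hζ0] at hη
  haveI := isGalois_algebraicClosure_adicCompletion (v := v)
  obtain ⟨a, ha⟩ := (InfiniteGalois.mem_range_algebraMap_iff_fixed
    (ζ : AlgebraicClosure (v.adicCompletion K))).mpr hfix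
  have haint : a ∈ v.adicCompletionIntegers K := by
    rw [← spectralValuation_algebraMap_le_one_iff hw, ha, hζ1]
  refine ⟨⟨a, haint⟩, ?_⟩
  change w (x - algebraMap (v.adicCompletion K) (AlgebraicClosure (v.adicCompletion K)) a) < 1
  rw [ha]
  exact hxζ

/-- **Unramified descent of congruence classes** ("`(𝒪_{K^nr}/ϖᵐ)^{Gal(K^nr/K)} = 𝓞_v/ϖᵐ`").
Let `x ∈ K̄_v` be fixed by the inertia group `I_𝔐` (i.e. `x ∈ K_v^nr`) with `|x|_v ≤ 1`, and
suppose `|σ x - x|_v ≤ |ϖ|_v^m` for every `σ ∈ Γ_{K_v}`. Then `|x - a|_v ≤ |ϖ|_v^m` for some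
`a ∈ 𝓞_v`. Induction on `m`: the class of `x` modulo `𝔐` contains some `a₀ ∈ 𝓞_v`
(`exists_spectralValuation_sub_algebraMap_lt_one`), `x - a₀ ∈ K_v^nr` has `|x - a₀|_v ≤ |ϖ|_v`
(discreteness of `|K_v^nr|_v`), and `(x - a₀)/ϖ` satisfies the hypothesis with `m - 1`.
Serre, *Local Fields*, Ch. II §4 and Ch. IV §4 (structure of `K^nr`); used for Silverman,
*AEC*, Prop. VII.5.4(a). [cite: SerreLocalFields1979, Ch. IV §4 Prop. 16 and Cor. 2] -/
theorem exists_spectralValuation_sub_algebraMap_le_pow {𝔐 : Ideal v.localAbsIntegers}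
    (h𝔐 : 𝔐 ∈ v.localPrimesAbove) {ϖ : v.adicCompletionIntegers K} (hϖ : Irreducible ϖ) (m : ℕ)
    {x : AlgebraicClosure (v.adicCompletion K)} (hx1 : w x ≤ 1)
    (hx : ∀ σ ∈ 𝔐.inertia (absoluteGaloisGroup (v.adicCompletion K)),
      absoluteGaloisGroup.toAlgEquiv (v.adicCompletion K) σ x = x)
    (hσ : ∀ σ : absoluteGaloisGroup (v.adicCompletion K),
      w (absoluteGaloisGroup.toAlgEquiv (v.adicCompletion K) σ x - x) ≤
        w (algebraMap (v.adicCompletion K) (AlgebraicClosure (v.adicCompletion K))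
          (ϖ : v.adicCompletion K)) ^ m) :
    ∃ a : v.adicCompletionIntegers K,
      w (x - algebraMap (v.adicCompletion K) (AlgebraicClosure (v.adicCompletion K))
        (a : v.adicCompletion K)) ≤
      w (algebraMap (v.adicCompletion K) (AlgebraicClosure (v.adicCompletion K))
          (ϖ : v.adicCompletion K)) ^ m := by
  obtain ⟨hc0, hc1⟩ := spectralValuation_uniformizer_pos_lt_one hw hϖ
  have hϖ0 : algebraMap (v.adicCompletion K) (AlgebraicClosure (v.adicCompletion K))
      (ϖ : v.adicCompletion K) ≠ 0 := (Valuation.pos_iff _).mp hc0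
  have hfixK : ∀ (σ : absoluteGaloisGroup (v.adicCompletion K)) (b : v.adicCompletion K),
      absoluteGaloisGroup.toAlgEquiv (v.adicCompletion K) σ
        (algebraMap (v.adicCompletion K) (AlgebraicClosure (v.adicCompletion K)) b) =
      algebraMap (v.adicCompletion K) (AlgebraicClosure (v.adicCompletion K)) b :=
    fun σ b => AlgEquiv.commutes _ _
  induction m generalizing x with
  | zero => exact ⟨0, by simpa using hx1⟩
  | succ m ih =>
    -- a representative modulo `𝔐`
    have hσ' : ∀ σ : absoluteGaloisGroup (v.adicCompletion K),
        w (absoluteGaloisGroup.toAlgEquiv (v.adicCompletion K) σ x - x) < 1 :=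
      fun σ => lt_of_le_of_lt (hσ σ) (pow_lt_one₀ zero_le hc1 (Nat.succ_ne_zero m))
    obtain ⟨a₀, ha₀⟩ := exists_spectralValuation_sub_algebraMap_lt_one hw hx1 hσ'
    -- `y = (x - a₀)/ϖ` is fixed by inertia, integral, and satisfies the hypothesis for `m`
    have hxa : ∀ σ ∈ 𝔐.inertia (absoluteGaloisGroup (v.adicCompletion K)),
        absoluteGaloisGroup.toAlgEquiv (v.adicCompletion K) σ
          (x - algebraMap (v.adicCompletion K) (AlgebraicClosure (v.adicCompletion K))
            (a₀ : v.adicCompletion K)) =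
        x - algebraMap (v.adicCompletion K) (AlgebraicClosure (v.adicCompletion K))
          (a₀ : v.adicCompletion K) := by
      intro σ hσI
      rw [map_sub, hx σ hσI, hfixK]
    have hle := spectralValuation_le_of_forall_inertia hw h𝔐 hϖ hxa ha₀
    have hy1 : w ((x - algebraMap (v.adicCompletion K) (AlgebraicClosure (v.adicCompletion K))
        (a₀ : v.adicCompletion K)) / algebraMap (v.adicCompletion K)
          (AlgebraicClosure (v.adicCompletion K)) (ϖ : v.adicCompletion K)) ≤ 1 := by
      rw [map_div₀, div_le_one₀ hc0]
      exact hle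
    have hyfix : ∀ σ ∈ 𝔐.inertia (absoluteGaloisGroup (v.adicCompletion K)),
        absoluteGaloisGroup.toAlgEquiv (v.adicCompletion K) σ
          ((x - algebraMap (v.adicCompletion K) (AlgebraicClosure (v.adicCompletion K))
            (a₀ : v.adicCompletion K)) / algebraMap (v.adicCompletion K)
              (AlgebraicClosure (v.adicCompletion K)) (ϖ : v.adicCompletion K)) =
        (x - algebraMap (v.adicCompletion K) (AlgebraicClosure (v.adicCompletion K))
            (a₀ : v.adicCompletion K)) / algebraMap (v.adicCompletion K)
              (AlgebraicClosure (v.adicCompletion K)) (ϖ : v.adicCompletion K) := by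
      intro σ hσI
      rw [map_div₀, hxa σ hσI, hfixK]
    have hyσ : ∀ σ : absoluteGaloisGroup (v.adicCompletion K),
        w (absoluteGaloisGroup.toAlgEquiv (v.adicCompletion K) σ
          ((x - algebraMap (v.adicCompletion K) (AlgebraicClosure (v.adicCompletion K))
            (a₀ : v.adicCompletion K)) / algebraMap (v.adicCompletion K)
              (AlgebraicClosure (v.adicCompletion K)) (ϖ : v.adicCompletion K)) -
          (x - algebraMap (v.adicCompletion K) (AlgebraicClosure (v.adicCompletion K))
            (a₀ : v.adicCompletion K)) / algebraMap (v.adicCompletion K)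
              (AlgebraicClosure (v.adicCompletion K)) (ϖ : v.adicCompletion K)) ≤
        w (algebraMap (v.adicCompletion K) (AlgebraicClosure (v.adicCompletion K))
          (ϖ : v.adicCompletion K)) ^ m := by
      intro σ
      rw [map_div₀, map_sub (absoluteGaloisGroup.toAlgEquiv (v.adicCompletion K) σ), hfixK,
        hfixK, ← sub_div, sub_sub_sub_cancel_right, map_div₀, div_le_iff₀ hc0, ← pow_succ]
      exact hσ σ
    obtain ⟨a₁, ha₁⟩ := ih hy1 hyfix hyσ
    refine ⟨a₀ + ϖ * a₁, ?_⟩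
    have e : x - algebraMap (v.adicCompletion K) (AlgebraicClosure (v.adicCompletion K))
        ((a₀ + ϖ * a₁ : v.adicCompletionIntegers K) : v.adicCompletion K) =
        algebraMap (v.adicCompletion K) (AlgebraicClosure (v.adicCompletion K))
          (ϖ : v.adicCompletion K) *
        ((x - algebraMap (v.adicCompletion K) (AlgebraicClosure (v.adicCompletion K))
            (a₀ : v.adicCompletion K)) / algebraMap (v.adicCompletion K)
              (AlgebraicClosure (v.adicCompletion K)) (ϖ : v.adicCompletion K) -
          algebraMap (v.adicCompletion K) (AlgebraicClosure (v.adicCompletion K))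
            (a₁ : v.adicCompletion K)) := by
      rw [Subring.coe_add, Subring.coe_mul, map_add, map_mul]
      field_simp
      ring
    rw [e, map_mul, pow_succ']
    exact mul_le_mul_right ha₁ _

end IsDedekindDomain.HeightOneSpectrum

end
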